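import Summits.AtomisticToContinuum.BoseEinsteinCondensation.Theses.BECModePrice
import Literature.MathematicalPhysics.QuantumManyBody.PeriodicBoseGasFracEnergy
import HarnessLib

/-!
# Crux `BECModePrice.ModePriceHardCore` (stmt-AtomisticToContinuum-18513), line `IdeatorSketchK1`
# (idea `tower-shadow`): stub `stub_uniformTower_of_scaleFree`

Scale-free single-mode softening (SMS) for INTEGRABLE repulsive finite-range potentials of range `≤ R₀`,
with constants `(C, ρ₀, N₀)` depending on the range bound `R₀` only, implies height-uniform SMS along the
truncation tower `min(v, n)` of every admissible (possibly non-integrable) `v`.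

Proof (instantiation): for `v` measurable and vanishing beyond `R₀(v)`, put `R₁ := max R₀(v) 1 > 0`;
every level `w_n := min(v, n)` is measurable, vanishes beyond `R₁`, and is integrable on `ℝ³`
(`w_n ≤ n · 𝟙_{B̄(0,R₁)}`, `lintegral_min_const_norm_ne_top`). Take `(C, ρ₀)` from the hypothesis at
`R₁`, the threshold `N₀` for `ρ ∈ (0, ρ₀)` (`Filter.eventually_ge_atTop`), and `n₀ := 0`.

## References

* [LSSY2005] E. H. Lieb, R. Seiringer, J. P. Solovej, J. Yngvason, *The Mathematics of the Bose Gas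
  and its Condensation*, Birkhäuser 2005, §1.2 and Ch. 2 (2.1) (finite-range repulsive potentials,
  hard cores allowed; truncation to bounded integrable profiles).
-/

noncomputable section

namespace Summit.AtomisticToContinuum.BoseEinsteinCondensation.Cruxes.ModePriceHardCore.TowerShadow

open MeasureTheory Filter
open scoped ENNReal NNReal Topology
open Literature.MathematicalPhysics.QuantumManyBody.BoseGas

/-- A level of the truncation tower of a profile vanishing beyond `R₁` is integrable on `ℝ³`:
`∫ min(v(|x|), n) dx ≤ n · |B̄(0, R₁)| < ∞`. [folklore] -/
theorem lintegral_min_const_norm_ne_top {v : ℝ → ℝ≥0∞} {R₁ : ℝ}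
    (hR : ∀ r, R₁ < r → v r = 0) (n : ℕ) :
    (∫⁻ x : Space, min (v ‖x‖) (n : ℝ≥0∞)) ≠ ⊤ := by
  have hbound : ∀ x : Space, min (v ‖x‖) (n : ℝ≥0∞)
      ≤ (Metric.closedBall (0 : Space) R₁).indicator (fun _ => (n : ℝ≥0∞)) x := by
    intro x
    by_cases hx : x ∈ Metric.closedBall (0 : Space) R₁
    · rw [Set.indicator_of_mem hx]
      exact min_le_right _ _
    · rw [Set.indicator_of_notMem hx, hR]
      · simp
      · rwa [Metric.mem_closedBall, dist_zero_right, not_le] at hx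
  refine ne_top_of_le_ne_top ?_ (lintegral_mono hbound)
  rw [lintegral_indicator measurableSet_closedBall, setLIntegral_const]
  exact ENNReal.mul_ne_top (ENNReal.natCast_ne_top n) measure_closedBall_lt_top.ne

/-- A level `min(v, n)` of the truncation tower of an admissible profile is admissible (measurable,
same range). [folklore] -/
theorem isRepulsiveFiniteRange_min_const {v : ℝ → ℝ≥0∞} (hv : IsRepulsiveFiniteRange v) (n : ℕ) :
    IsRepulsiveFiniteRange fun r => min (v r) (n : ℝ≥0∞) := by
  obtain ⟨R₀, hR₀⟩ := hv.2
  exact ⟨hv.1.min measurable_const, R₀, fun r hr => by simp [hR₀ r hr]⟩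

/-- **Stub W1 `stub_uniformTower_of_scaleFree`.** Scale-free integrable SMS (constants depending on the
range bound `R₀` only) ⇒ height-uniform SMS along the truncation tower `min(v,n)` of every admissible
non-integrable `v`: each level is measurable, vanishes beyond the range of `v`, and is integrable
(`≤ n` on the ball of radius `max R₀(v) 1`). -/
theorem stub_uniformTower_of_scaleFree :
    (∀ R₀ : ℝ, 0 < R₀ → ∃ C : ℝ, 0 < C ∧ ∃ ρ₀ : ℝ, 0 < ρ₀ ∧ ∀ ρ : ℝ, 0 < ρ → ρ < ρ₀ →
      ∃ N₀ : ℕ, ∀ N : ℕ, N₀ ≤ N → ∀ p : Fin 3 → ℤ, p ≠ 0 →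
        ∀ v : ℝ → ℝ≥0∞, IsRepulsiveFiniteRange v → (∀ r, R₀ < r → v r = 0) →
          (∫⁻ x : Space, v ‖x‖) ≠ ⊤ →
          ∀ Ψ : PeriodicTrialState N (sideLength ρ N),
            periodicGroundStateEnergy v N (sideLength ρ N)
                + 2⁻¹ * fracDispersion 2 (sideLength ρ N) p
                  * cellOccupation N (sideLength ρ N) (planeWaveMode (sideLength ρ N) p) Ψ.ψ
              ≤ periodicEnergy v Ψ + ENNReal.ofReal (C * ρ)) →
    ∀ v : ℝ → ℝ≥0∞, IsRepulsiveFiniteRange v → (∫⁻ x : Space, v ‖x‖) = ⊤ →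
      ∃ C : ℝ, 0 < C ∧ ∃ ρ₀ : ℝ, 0 < ρ₀ ∧ ∀ ρ : ℝ, 0 < ρ → ρ < ρ₀ →
        ∀ᶠ N : ℕ in atTop, ∀ p : Fin 3 → ℤ, p ≠ 0 → ∃ n₀ : ℕ, ∀ n : ℕ, n₀ ≤ n →
          ∀ Ψ : PeriodicTrialState N (sideLength ρ N),
            periodicGroundStateEnergy (fun r => min (v r) (n : ℝ≥0∞)) N (sideLength ρ N)
                + 2⁻¹ * fracDispersion 2 (sideLength ρ N) p
                  * cellOccupation N (sideLength ρ N) (planeWaveMode (sideLength ρ N) p) Ψ.ψ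
              ≤ periodicEnergy (fun r => min (v r) (n : ℝ≥0∞)) Ψ + ENNReal.ofReal (C * ρ) := by
  intro hSF v hv _
  obtain ⟨R₀, hR₀⟩ := hv.2
  -- a positive range bound beyond which `v` (hence every level of its tower) vanishes
  have hR₁ : ∀ r, max R₀ 1 < r → v r = 0 := fun r hr => hR₀ r (lt_of_le_of_lt (le_max_left _ _) hr)
  obtain ⟨C, hC, ρ₀, hρ₀, hmain⟩ := hSF (max R₀ 1) (lt_of_lt_of_le one_pos (le_max_right _ _))
  refine ⟨C, hC, ρ₀, hρ₀, fun ρ hρ hρlt => ?_⟩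
  obtain ⟨N₀, hN₀⟩ := hmain ρ hρ hρlt
  filter_upwards [eventually_ge_atTop N₀] with N hN
  intro p hp
  refine ⟨0, fun n _ => ?_⟩
  exact hN₀ N hN p hp (fun r => min (v r) (n : ℝ≥0∞)) (isRepulsiveFiniteRange_min_const hv n)
    (fun r hr => by simp [hR₁ r hr]) (lintegral_min_const_norm_ne_top hR₁ n)

end Summit.AtomisticToContinuum.BoseEinsteinCondensation.Cruxes.ModePriceHardCore.TowerShadow

end
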